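import Literature.Computability.AlgebraicComplexity.BI17SmoothTernaryCubicPolystable
import Literature.Computability.AlgebraicComplexity.BI17BinaryQuarticPolystableProofs
import Literature.NumberTheory.Automorphic.ProjectiveElimination
import Mathlib.RingTheory.MvPolynomial.EulerIdentity
import HarnessLib

/-!
# Almost all ternary cubics are polystable — the `(D, m) = (3, 3)` case of Bürgisser–Ikenmeyer
# 2017, Prop. 2.10, and the exact residual of the fact after the explicit slices

Sibling proof file of `Literature/Computability/AlgebraicComplexity/BI17FundamentalInvariantForms.lean`
(cell `val-lit`, DAG row BI2017-A). P. Bürgisser, C. Ikenmeyer, J. Algebra 477 (2017) =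
arXiv:1511.02927, **Prop. 2.10** ("if `D > 1`, almost all `w ∈ Sym^D ℂ^m` are polystable").
Continues `BI17SmoothTernaryCubicPolystable.lean` (every SMOOTH ternary cubic is polystable, via the
tree's Artebani–Dolgachev Lemma 1 and the polystable Hesse pencil):

* `BI2017_prop_2_10_three_three : IsZariskiGeneric 3 (IsPolystable : MvPolynomial (Fin 3) ℂ → Prop)`
  — the genericity polynomial is obtained (non-constructively) from the tree's **main theorem of
  elimination theory on `ℂ`-points** (`Literature.NumberTheory.Automorphic.isClosed_setOf_exists_common_zero`:
  the cubics whose three partials have a common non-zero zero form a Zariski-closed subset of the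
  coefficient space `Sym³ ℂ³`), which misses the Fermat cubic;
* `BI2017_prop_2_10_of_residual` — bookkeeping: the named fact now follows from its instances with
  `m ≥ 4`, `m = 3 ∧ D ≥ 4`, `m = 2 ∧ D ≥ 5` (printed proof: Thm. 2.3 + Luna 1973; none of these is
  proved in the tree — no explicit normal forms exist there).

Everything is PROVED; no definitions, no named facts. Honest framing: bookkeeping of classical
invariant theory inside the BIP literature programme; nothing here bears on lower bounds or on `VP`
versus `VNP`.
-/

noncomputable section

open MvPolynomial

namespace Literature.Computability.AlgebraicComplexity

/-! ### The `(3, 3)` slice of Prop. 2.10: almost all ternary cubics are polystable -/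

section Generic

open Literature.NumberTheory.Automorphic in
/-- **BI 2017, Prop. 2.10 at `(D, m) = (3, 3)`: almost all ternary cubics are polystable.**
`IsZariskiGeneric 3 IsPolystable` on `Sym³ ℂ³`. The test polynomial is NOT written down: by the
main theorem of elimination theory on `ℂ`-points (tree:
`Literature.NumberTheory.Automorphic.isClosed_setOf_exists_common_zero`, projective space is
complete) applied to the three partial derivatives of the generic ternary cubic, the cubics with a
singular point form a Zariski-closed subset of coefficient space; it misses the Fermat cubic, so some
polynomial of its defining set does not vanish at `x³ + y³ + z³` — that polynomial is the witness, and
off its zeros every cubic is smooth, hence polystable (`isPolystable_of_forall_regular_ternaryCubic`).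
The general `m ≥ 3` body of Prop. 2.10 (Thm. 2.3 + Luna 1973) is NOT proved here.
[cite: BurgisserIkenmeyer2017, Prop. 2.10 (case (D, m) = (3, 3), TeX L633–640)] -/
theorem BI2017_prop_2_10_three_three :
    IsZariskiGeneric 3 (IsPolystable : MvPolynomial (Fin 3) ℂ → Prop) := by
  classical
  -- the generic ternary cubic over the coefficient ring `ℂ[Sym³ ℂ³]`
  set G : MvPolynomial (Fin 3) (MvPolynomial (DegIdx (Fin 3) 3) ℂ) :=
    ∑ d : DegIdx (Fin 3) 3, C (X d) * monomial d.1 1 with hG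
  have hGhom : G.IsHomogeneous 3 :=
    IsHomogeneous.sum _ _ _ fun d _ =>
      (isHomogeneous_monomial (1 : MvPolynomial (DegIdx (Fin 3) 3) ℂ) (mem_degMonomials_iff.mp d.2)).C_mul _
  -- its specialisation at the coefficient vector of a form `F` of degree `3` is `F`
  have hspec : ∀ F : MvPolynomial (Fin 3) ℂ, F.IsHomogeneous 3 → specialize (formCoeff 3 F) G = F := by
    intro F hF
    rw [specialize, hG, map_sum]
    conv_rhs => rw [← sum_coeff_smul_monomial_eq hF]
    refine Finset.sum_congr rfl fun d _ => ?_
    rw [map_mul, map_C, eval_X, map_monomial, map_one, formCoeff_apply, smul_eq_C_mul]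
  -- the three partial derivatives, homogeneous of degree `2`
  set f : Fin 3 → MvPolynomial (Fin 3) (MvPolynomial (DegIdx (Fin 3) 3) ℂ) := fun i => pderiv i G
    with hf
  have hfhom : ∀ j, (f j).IsHomogeneous 2 := fun j => hGhom.pderiv
  have hfspec : ∀ (F : MvPolynomial (Fin 3) ℂ), F.IsHomogeneous 3 → ∀ j,
      specialize (formCoeff 3 F) (f j) = pderiv j F := by
    intro F hF j
    rw [hf]
    dsimp only
    rw [specialize, ← pderiv_map, ← specialize, hspec F hF]
  -- the singular cubics form a closed set …
  have hS := isClosed_setOf_exists_common_zero f hfhom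
  obtain ⟨T, hT⟩ := isClosed_iff_exists_setOf_eval.mp hS
  -- … missing the Fermat cubic
  set F₀ : MvPolynomial (Fin 3) ℂ := X 0 ^ 3 + X 1 ^ 3 + X 2 ^ 3 with hF₀
  have hF₀hom : F₀.IsHomogeneous 3 :=
    ((isHomogeneous_X_pow (0 : Fin 3) 3).add (isHomogeneous_X_pow 1 3)).add (isHomogeneous_X_pow 2 3)
  have hF₀grad : ∀ (x : Fin 3 → ℂ) (j : Fin 3), eval x (pderiv j F₀) = 3 * x j ^ 2 := by
    intro x j
    fin_cases j <;>
      simp [hF₀, (pderiv _).leibniz_pow, pderiv_X]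
  have hy₀ : formCoeff 3 F₀ ∉ {y : DegIdx (Fin 3) 3 → ℂ |
      ∃ x : Fin 3 → ℂ, x ≠ 0 ∧ ∀ j, eval x (specialize y (f j)) = 0} := by
    rintro ⟨x, hx, hzero⟩
    apply hx
    funext j
    have h := hzero j
    rw [hfspec F₀ hF₀hom, hF₀grad] at h
    simpa using h
  rw [hT] at hy₀
  simp only [Set.mem_setOf_eq, not_forall] at hy₀
  obtain ⟨Φ, hΦT, hΦ0⟩ := hy₀
  refine ⟨Φ, fun h => hΦ0 (by rw [h, map_zero]), fun F hF hΦF => ?_⟩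
  -- off `Φ = 0` the cubic is smooth, hence polystable
  refine isPolystable_of_forall_regular_ternaryCubic hF fun p hp _ hgrad => ?_
  have hmem : formCoeff 3 F ∈ {y : DegIdx (Fin 3) 3 → ℂ |
      ∃ x : Fin 3 → ℂ, x ≠ 0 ∧ ∀ j, eval x (specialize y (f j)) = 0} := by
    refine ⟨p, hp, fun j => ?_⟩
    rw [hfspec F hF]
    exact congr_fun hgrad j
  rw [hT] at hmem
  have hval : eval (formCoeff 3 F) Φ = 0 := hmem Φ hΦT
  exact hΦF (by rw [← hval]; rfl)

end Generic

/-- **Exact residual of Prop. 2.10 after the four slice files**: the named fact follows from its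
instances with `m ≥ 4` (`D ≥ 3`), `m = 3 ∧ D ≥ 4`, and `m = 2 ∧ D ≥ 5` — none of which is proved in the
tree (printed proof: Thm. 2.3 + Luna 1973); `D = 2`, `m ≤ 1`, `(3,2)`, `(4,2)`, `(3,3)` are theorems.
[cite: BurgisserIkenmeyer2017, Prop. 2.10] -/
theorem BI2017_prop_2_10_of_residual
    (h : ∀ (D m : ℕ), 3 ≤ D → 2 ≤ m → (m = 2 → 5 ≤ D) → (m = 3 → 4 ≤ D) →
      IsZariskiGeneric D (IsPolystable : MvPolynomial (Fin m) ℂ → Prop)) :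
    BI2017_prop_2_10 := by
  refine BI2017_prop_2_10_of_main'' fun D m hD hm h2 => ?_
  by_cases h33 : (D, m) = (3, 3)
  · obtain ⟨rfl, rfl⟩ : D = 3 ∧ m = 3 := by simpa using h33
    exact BI2017_prop_2_10_three_three
  · refine h D m hD hm h2 fun hm3 => ?_
    subst hm3
    by_contra hlt
    exact h33 (by rw [show D = 3 by omega])

end Literature.Computability.AlgebraicComplexity

end
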